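import Summits.BirchSwinnertonDyer.BirchSwinnertonDyer.Theorems.KolyvaginDepthDoorDepthTableSteinWuthrichRows8
import Summits.BirchSwinnertonDyer.BirchSwinnertonDyer.Theorems.KolyvaginDepthDoorDepthTableRows997TwoShaModRank
import HarnessLib

/-!
# Route `KolyvaginDepthDoor`, crux `KolyvaginDepthSupplyKN` (stmt-BirchSwinnertonDyer-22820) —
# DEPTH TABLE v13 (part 9): the UNCERTIFIED prime-conductor curves `997b1`, `997c1` — `Ш(E)[5] = 0` by name from
# `2 ≤ rank` only; the crux's clause at each modulo ONE rank-one datum (no 2-descent certificate needed)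

Helper file of the lead prover of line `levelone` (kdd-p1 g17; `--supports stmt-BirchSwinnertonDyer-22820
--as helper`); it closes nothing and BSD is NOT proved by it.

Sequel of part 8 (`KolyvaginDepthDoorDepthTableSteinWuthrichRows8`). First the GENERIC corollary
`cruxBody_of_twistSelmer_of_steinWuthrich`: for EVERY curve in the Stein–Wuthrich range (non-CM, `2 ≤ rank`,
`N ≤ 30 000`, `5 ≤ p < 1000` admissible) on the ♠ cell, the crux's clause at the curve follows from ONE bound
`#Sel_p(E^{(d_K)}/ℚ) ≤ p ^ rank` on one Heegner twist (SW Thm. 1.1 + part 8's generic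
`cruxBody_of_sha_of_twistSelmer_of_lemma84` and the pattern at `794a1`). Per curve (`C997b1`, `C997c1`):
`sha_inf_torsionBy_five_eq_bot` (Stein–Wuthrich 2013 Thm. 1.1 BY NAME at the kernel certificates: non-CM, two kernel
points `KernelCertsR01.C997b1.two_le_rank` / `KernelCerts003.C997c1.two_le_rank`, `N = 997`, `5` good ordinary,
`ρ̄_{E,5}` onto), `exactRowZhang_5_neg23_oneTwistModRank` (the v12 «two Ш» row at the alternative Heegner field
`d_K = −23` with the `E`-side `Ш` conjunct discharged: bit `↔` «`rank E = 2` ∧ `rank E^{(−23)} = 1` ∧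
`Ш(E^{(−23)})[5] = 0`»), and `cruxBody_of_twistSelmer` — the CLAUSE of the crux at the curve, verbatim, from ONE
bound `#Sel_5(E^{(d_K)}/ℚ) ≤ 5` at the field of record (`−52`, `−67`), with NO rank certificate beyond the two
kernel points (the crux's first sign asks `ν + 1 ≤ rank`, W. Zhang's class sits at depth `rank − 1`).

CONDITIONAL on W. Zhang 2014 Lemma 8.4 (1) / Thm. 9.1, (γ) = Gross 1991 Prop. 3.7 (2) (rows only) and Stein–Wuthrich
2013 Thm. 1.1, BY NAME; per curve; nothing class-wide (the open stub (S♭) is untouched); BSD is NOT proved by any of this.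

References: [SteinWuthrich2013] Thm. 1.1 (p. 1758), §12.4; [WZhang2014] Lemma 8.4 (1) (p. 236), Thm. 9.1 (p. 240);
[GrossLMS1991] Prop. 3.7 (2); [CremonaAlgorithms1997] Table 1 (997b1, 997c1).
-/

set_option linter.dupNamespace false

noncomputable section

open scoped Classical NumberField

namespace Summit.BirchSwinnertonDyer.BirchSwinnertonDyer.Theorems.KolyvaginDepthDoor

open Literature.NumberTheory.EllipticCurves Literature.NumberTheory.EllipticCurves.ModularForms
  WeierstrassCurve NumberField IsDedekindDomain
open Summit.BirchSwinnertonDyer.BirchSwinnertonDyer.Theorems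
open Summit.BirchSwinnertonDyer.BirchSwinnertonDyer.Rank2Observatory

/-! ## Generic: in the Stein–Wuthrich range the crux's clause at a ♠-cell curve is ONE twist datum away -/

/-- **In the Stein–Wuthrich range, the clause of `KolyvaginDepthSupplyKN` at a curve is ONE twist `p`-Selmer
datum away** (generic). `W` globally minimal, non-CM, `2 ≤ rank_ℤ E(ℚ)`, `N_E ≤ 30 000`; `5 ≤ p < 1000` good
ordinary with `ρ_{E,p^n}` onto for all `n`, Kodaira–Néron at `p`, ♠ (1) and ♠ (2) (`p`-form); `K` imaginary
quadratic, `d_K ∉ {−3, −4}`, `p ∤ d_K`, Heegner for `N_E`. IF `#Sel_p(E^{(d_K)}/ℚ) ≤ p ^ rank_ℤ E(ℚ)` THEN the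
crux's clause holds at `W` verbatim: `Ш(E/ℚ)[p] = 0` is Stein–Wuthrich 2013 Thm. 1.1 (named fact `hSW`), and
`cruxBody_of_sha_of_twistSelmer_of_lemma84` (part 8; W. Zhang L8.4 (1) by name) does the rest. So for EVERY
curve of the SW table on the ♠ cell the instrument's closing datum is a bound on ONE quadratic twist's
`p`-Selmer group — no Kolyvagin class, no `p`-adic `L`-function of `E`. CONDITIONAL on the two named facts;
per `(E, p, K)`; nothing class-wide; BSD is not proved by it.
[cite: SteinWuthrich2013, Thm. 1.1 (p. 1758)] [cite: WZhang2014, Lemma 8.4 (1) (p. 236), Thm. 9.1 (p. 240)] -/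
theorem cruxBody_of_twistSelmer_of_steinWuthrich
    (hSW : SteinWuthrich2013_sha_inf_torsionBy_eq_bot_of_two_le_rank)
    (h84 : Literature.NumberTheory.EllipticCurves.WZhang2014_lemma84_exists_minimal_kolyvaginClass_one_selmerCard)
    (W : WeierstrassCurve ℚ) [W.IsElliptic] [W.IsGloballyMinimal] (hcm : ¬ W.HasCM) (hr : 2 ≤ W.mordellWeilRank)
    (hN : W.conductorNorm ℤ ≤ 30000)
    (p : ℕ) [hp : Fact p.Prime] (h5 : 5 ≤ p) (hp1000 : p < 1000) (hgood : W.HasGoodReductionAtPrime p)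
    (hord : ¬ (p : ℤ) ∣ W.frobeniusTrace p)
    (htower : ∀ n : ℕ, W.HasSurjectiveModNGaloisRep (p ^ n : ℕ))
    (hKN : ∀ v : HeightOneSpectrum (𝓞 ℚ), W.HasMultiplicativeReductionAt v →
      ¬ p ∣ W.ordMinimalDiscriminant v)
    (hS1 : ∀ (ℓ : ℕ) [Fact ℓ.Prime], W.HasMultiplicativeReductionAtPrime ℓ →
      ¬ p ∣ padicValInt ℓ W.minimalDiscriminantInt)
    (hS2 : ¬ Squarefree (W.conductorNorm ℤ) →
      (∃ (ℓ : ℕ) (_ : Fact ℓ.Prime), W.HasMultiplicativeReductionAtPrime ℓ ∧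
          ¬ p ∣ padicValInt ℓ W.minimalDiscriminantInt) ∧
        ∃ (ℓ₁ ℓ₂ : ℕ) (_ : Fact ℓ₁.Prime) (_ : Fact ℓ₂.Prime), ℓ₁ ≠ ℓ₂ ∧
          W.HasMultiplicativeReductionAtPrime ℓ₁ ∧ W.HasMultiplicativeReductionAtPrime ℓ₂)
    (K : Type) [Field K] [NumberField K] (hK : IsImaginaryQuadratic K)
    (hD3 : NumberField.discr K ≠ -3) (hD4 : NumberField.discr K ≠ -4)
    (hpD : ¬ ((p : ℤ) ∣ NumberField.discr K))
    [iNZ : NeZero (W.conductorNorm ℤ)] (hH : SatisfiesHeegnerHypothesis (W.conductorNorm ℤ) K)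
    (hT : Nat.card ((W.quadraticTwist (NumberField.discr K : ℚ)).selmerGroup p) ≤ p ^ W.mordellWeilRank) :
    ∃ (p : ℕ) (hp : Fact p.Prime), 5 ≤ p ∧ W.HasGoodReductionAtPrime p ∧
      ¬ (p : ℤ) ∣ W.frobeniusTrace p ∧ (∀ n : ℕ, W.HasSurjectiveModNGaloisRep (p ^ n : ℕ)) ∧
      (∀ v : HeightOneSpectrum (𝓞 ℚ), W.HasMultiplicativeReductionAt v →
        ¬ p ∣ W.ordMinimalDiscriminant v) ∧
      ∃ (K : Type) (_ : Field K) (_ : NumberField K), IsImaginaryQuadratic K ∧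
        NumberField.discr K ≠ -3 ∧ NumberField.discr K ≠ -4 ∧
        ∃ (_ : NeZero (W.conductorNorm ℤ)), SatisfiesHeegnerHypothesis (W.conductorNorm ℤ) K ∧
        ∃ (Dt : ModularParametrizationData W (W.conductorNorm ℤ)) (β : ℤ) (ι : K →+* ℂ) (n₁ : ℕ)
          (d : KolyvaginHeegnerData Dt β ι n₁), Squarefree n₁ ∧
          (∀ q ∈ n₁.primeFactors, Zhang2014.IsKolyvaginPrime (W.conductorNorm ℤ) W K p q) ∧
          d.kolyvaginClass hp.out 1 ≠ 0 ∧
          (n₁.primeFactors.card + 1 ≤ W.mordellWeilRank ∨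
            (n₁.primeFactors.card ≤ W.mordellWeilRank ∧
              n₁.primeFactors.card + 1 ≤ (W.quadraticTwist (NumberField.discr K : ℚ)).mordellWeilRank)) := by
  have hsur : W.HasSurjectiveModNGaloisRep p := by simpa only [pow_one] using htower 1
  exact cruxBody_of_sha_of_twistSelmer_of_lemma84 h84 W hr p h5 hgood hord htower hKN hS1 hS2 K hK hD3 hD4
    hpD hH (hSW W hcm hr hN p h5 hp1000 hgood hord hsur) hT

/-! ## `997b1` (`N = 997`, no 2-descent certificate; `2 ≤ rank` by `KernelCertsR01.C997b1.two_le_rank`) -/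

namespace C997b1

/-- **`Ш(997b1/ℚ)[5] = 0` BY NAME** (Stein–Wuthrich 2013 Thm. 1.1: non-CM `not_hasCM`, `2 ≤ rank` `KernelCertsR01.C997b1.two_le_rank` — two
kernel points, NO 2-descent certificate needed —, `N = 997 ≤ 30000` `conductorNorm_eq`, `5` good ordinary `goodOrdinary_5`,
`ρ̄_{E,5}` onto `hasSurjectiveModNGaloisRep_pow_5 1`). CONDITIONAL on that named fact; per curve; BSD is not proved by it.
[cite: SteinWuthrich2013, Thm. 1.1 (p. 1758)] [cite: CremonaAlgorithms1997, Table 1 (997b1)] -/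
theorem sha_inf_torsionBy_five_eq_bot (hSW : SteinWuthrich2013_sha_inf_torsionBy_eq_bot_of_two_le_rank) :
    haveI := isElliptic_c997b1;
    haveI := isGloballyMinimal_c997b1;
    haveI := Fact.mk (by norm_num : Nat.Prime 5);
    (((⟨0, -1, 1, -5, -3⟩ : WeierstrassCurve ℤ).map (Int.castRingHom ℚ)).sha ⊓ AddSubgroup.torsionBy ((⟨0, -1, 1, -5, -3⟩ : WeierstrassCurve ℤ).map (Int.castRingHom ℚ)).galH1 ((5 : ℕ) : ℤ) : AddSubgroup _) = ⊥ := by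
  haveI := isElliptic_c997b1
  haveI := isGloballyMinimal_c997b1
  haveI := Fact.mk (by norm_num : Nat.Prime 5)
  have hsur : ((⟨0, -1, 1, -5, -3⟩ : WeierstrassCurve ℤ).map (Int.castRingHom ℚ)).HasSurjectiveModNGaloisRep (5 ^ 1 : ℕ) := hasSurjectiveModNGaloisRep_pow_5 1
  rw [pow_one] at hsur
  exact hSW _ not_hasCM KernelCertsR01.C997b1.two_le_rank (by rw [conductorNorm_eq]; norm_num) 5 (by norm_num) (by norm_num)
    goodOrdinary_5.1 goodOrdinary_5.2 hsur

/-- **DEPTH-TABLE ROW `997b1`, `(p, d_K) = (5, -23)`, v13 modulo the rank of `E` — «ONE BIT ⟺ `rank E = 2` ∧ ONE TWIST».**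
For `E = 997b1` and ANY imaginary quadratic `K` with `d_K = -23`: bit `↔` «`rank_ℤ E(ℚ) = 2` ∧ `rank_ℤ E^{(-23)}(ℚ) = 1` ∧
`Ш(E^{(-23)}/ℚ)[5] = 0`» — from the v12 row `exactRowZhang_5_neg23_twoShaModRank` with its `E`-side conjunct `Ш(E)[5] = 0`
discharged by SW Thm. 1.1; the `rank E = 2` conjunct stays (no 2-descent certificate; it drops by `and_iff_right` when the
observatory lands one). CONDITIONAL on (γ), W. Zhang L8.4 (1) / 9.1 and SW Thm. 1.1 by name; per curve; BSD is not proved by it.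
[cite: SteinWuthrich2013, Thm. 1.1 (p. 1758)] [cite: WZhang2014, Lemma 8.4 (1) (p. 236), Thm. 9.1 (p. 240)] [cite: GrossLMS1991, Prop. 3.7 (2)] -/
theorem exactRowZhang_5_neg23_oneTwistModRank
    (hSW : SteinWuthrich2013_sha_inf_torsionBy_eq_bot_of_two_le_rank)
    (h372 : GrossLMS1991.prop37_2_frobeniusCongruence)
    (h84 : Literature.NumberTheory.EllipticCurves.WZhang2014_lemma84_exists_minimal_kolyvaginClass_one_selmerCard)
    (K : Type) [Field K] [NumberField K] (hK : IsImaginaryQuadratic K)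
    (hD : NumberField.discr K = -23) :
    haveI := isElliptic_c997b1;
    haveI := isGloballyMinimal_c997b1;
    haveI : NeZero (((⟨0, -1, 1, -5, -3⟩ : WeierstrassCurve ℤ).map (Int.castRingHom ℚ)).conductorNorm ℤ) := neZero_conductorNorm_of_isElliptic _;
    haveI := Fact.mk (by norm_num : Nat.Prime 5);
    (∃ (Dt : ModularParametrizationData ((⟨0, -1, 1, -5, -3⟩ : WeierstrassCurve ℤ).map (Int.castRingHom ℚ)) (((⟨0, -1, 1, -5, -3⟩ : WeierstrassCurve ℤ).map (Int.castRingHom ℚ)).conductorNorm ℤ)) (β : ℤ)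
      (ι : K →+* ℂ) (ℓ : ℕ) (d : KolyvaginHeegnerData Dt β ι ℓ),
      ℓ.Prime ∧ Zhang2014.IsKolyvaginPrime (((⟨0, -1, 1, -5, -3⟩ : WeierstrassCurve ℤ).map (Int.castRingHom ℚ)).conductorNorm ℤ) ((⟨0, -1, 1, -5, -3⟩ : WeierstrassCurve ℤ).map (Int.castRingHom ℚ)) K 5 ℓ ∧
        d.kolyvaginClass (p := 5) (by norm_num) 1 ≠ 0) ↔
    (((⟨0, -1, 1, -5, -3⟩ : WeierstrassCurve ℤ).map (Int.castRingHom ℚ)).mordellWeilRank = 2 ∧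
      (((⟨0, -1, 1, -5, -3⟩ : WeierstrassCurve ℤ).map (Int.castRingHom ℚ)).quadraticTwist (NumberField.discr K : ℚ)).mordellWeilRank = 1 ∧
      ((((⟨0, -1, 1, -5, -3⟩ : WeierstrassCurve ℤ).map (Int.castRingHom ℚ)).quadraticTwist (NumberField.discr K : ℚ)).sha ⊓
          AddSubgroup.torsionBy (((⟨0, -1, 1, -5, -3⟩ : WeierstrassCurve ℤ).map (Int.castRingHom ℚ)).quadraticTwist (NumberField.discr K : ℚ)).galH1 ((5 : ℕ) : ℤ) :
          AddSubgroup (((⟨0, -1, 1, -5, -3⟩ : WeierstrassCurve ℤ).map (Int.castRingHom ℚ)).quadraticTwist (NumberField.discr K : ℚ)).galH1) = ⊥) := by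
  haveI := isElliptic_c997b1
  haveI := isGloballyMinimal_c997b1
  haveI : NeZero (((⟨0, -1, 1, -5, -3⟩ : WeierstrassCurve ℤ).map (Int.castRingHom ℚ)).conductorNorm ℤ) := neZero_conductorNorm_of_isElliptic _
  haveI := Fact.mk (by norm_num : Nat.Prime 5)
  exact (exactRowZhang_5_neg23_twoShaModRank h372 h84 K hK hD).trans
    (and_congr_right fun _ ↦ and_iff_right (sha_inf_torsionBy_five_eq_bot hSW))

/-- **THE CRUX `KolyvaginDepthSupplyKN` AT `997b1`, MODULO ONE RANK-ONE DATUM — NO 2-DESCENT CERTIFICATE NEEDED.**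
Granted SW Thm. 1.1 and W. Zhang L8.4 (1) / 9.1 by name and, for ONE imaginary quadratic `K` with `d_K = -52` (field of
record), the bound `#Sel_5(E^{(d_K)}/ℚ) ≤ 5` on the rank-one Heegner twist, the CLAUSE of the crux holds at `W = 997b1`
verbatim (`cruxBody_of_sha_of_twistSelmer_of_lemma84` at the kernel certificates: two points `KernelCertsR01.C997b1.two_le_rank`, `5` good
ordinary, `ρ_{E,5^∞}` onto, Kodaira–Néron and ♠ from `Δ(E₀) = 997` (`spade_5`), Heegner `heegner_neg52`; `5 ≤ 5 ^ rank`).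
CONDITIONAL on the two named facts and the one twist datum; per curve; BSD is not proved by it.
[cite: SteinWuthrich2013, Thm. 1.1 (p. 1758)] [cite: WZhang2014, Lemma 8.4 (1) (p. 236), Thm. 9.1 (p. 240)] [cite: CremonaAlgorithms1997, Table 1 (997b1)] -/
theorem cruxBody_of_twistSelmer
    (hSW : SteinWuthrich2013_sha_inf_torsionBy_eq_bot_of_two_le_rank)
    (h84 : Literature.NumberTheory.EllipticCurves.WZhang2014_lemma84_exists_minimal_kolyvaginClass_one_selmerCard)
    (K : Type) [Field K] [NumberField K] (hK : IsImaginaryQuadratic K)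
    (hD : NumberField.discr K = -52)
    (hT : haveI := isElliptic_c997b1; haveI := isGloballyMinimal_c997b1;
      Nat.card ((((⟨0, -1, 1, -5, -3⟩ : WeierstrassCurve ℤ).map (Int.castRingHom ℚ)).quadraticTwist (NumberField.discr K : ℚ)).selmerGroup (5 : ℕ)) ≤ 5) :
    haveI := isElliptic_c997b1;
    haveI := isGloballyMinimal_c997b1;
    ∃ (p : ℕ) (hp : Fact p.Prime), 5 ≤ p ∧ ((⟨0, -1, 1, -5, -3⟩ : WeierstrassCurve ℤ).map (Int.castRingHom ℚ)).HasGoodReductionAtPrime p ∧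
      ¬ (p : ℤ) ∣ ((⟨0, -1, 1, -5, -3⟩ : WeierstrassCurve ℤ).map (Int.castRingHom ℚ)).frobeniusTrace p ∧ (∀ n : ℕ, ((⟨0, -1, 1, -5, -3⟩ : WeierstrassCurve ℤ).map (Int.castRingHom ℚ)).HasSurjectiveModNGaloisRep (p ^ n : ℕ)) ∧
      (∀ v : HeightOneSpectrum (𝓞 ℚ), ((⟨0, -1, 1, -5, -3⟩ : WeierstrassCurve ℤ).map (Int.castRingHom ℚ)).HasMultiplicativeReductionAt v →
        ¬ p ∣ ((⟨0, -1, 1, -5, -3⟩ : WeierstrassCurve ℤ).map (Int.castRingHom ℚ)).ordMinimalDiscriminant v) ∧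
      ∃ (K : Type) (_ : Field K) (_ : NumberField K), IsImaginaryQuadratic K ∧
        NumberField.discr K ≠ -3 ∧ NumberField.discr K ≠ -4 ∧
        ∃ (_ : NeZero (((⟨0, -1, 1, -5, -3⟩ : WeierstrassCurve ℤ).map (Int.castRingHom ℚ)).conductorNorm ℤ)), SatisfiesHeegnerHypothesis (((⟨0, -1, 1, -5, -3⟩ : WeierstrassCurve ℤ).map (Int.castRingHom ℚ)).conductorNorm ℤ) K ∧
        ∃ (Dt : ModularParametrizationData ((⟨0, -1, 1, -5, -3⟩ : WeierstrassCurve ℤ).map (Int.castRingHom ℚ)) (((⟨0, -1, 1, -5, -3⟩ : WeierstrassCurve ℤ).map (Int.castRingHom ℚ)).conductorNorm ℤ)) (β : ℤ) (ι : K →+* ℂ) (n₁ : ℕ)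
          (d : KolyvaginHeegnerData Dt β ι n₁), Squarefree n₁ ∧
          (∀ q ∈ n₁.primeFactors, Zhang2014.IsKolyvaginPrime (((⟨0, -1, 1, -5, -3⟩ : WeierstrassCurve ℤ).map (Int.castRingHom ℚ)).conductorNorm ℤ) ((⟨0, -1, 1, -5, -3⟩ : WeierstrassCurve ℤ).map (Int.castRingHom ℚ)) K p q) ∧
          d.kolyvaginClass hp.out 1 ≠ 0 ∧
          (n₁.primeFactors.card + 1 ≤ ((⟨0, -1, 1, -5, -3⟩ : WeierstrassCurve ℤ).map (Int.castRingHom ℚ)).mordellWeilRank ∨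
            (n₁.primeFactors.card ≤ ((⟨0, -1, 1, -5, -3⟩ : WeierstrassCurve ℤ).map (Int.castRingHom ℚ)).mordellWeilRank ∧
              n₁.primeFactors.card + 1 ≤ (((⟨0, -1, 1, -5, -3⟩ : WeierstrassCurve ℤ).map (Int.castRingHom ℚ)).quadraticTwist (NumberField.discr K : ℚ)).mordellWeilRank)) := by
  haveI := isElliptic_c997b1
  haveI := isGloballyMinimal_c997b1
  haveI iNZ : NeZero (((⟨0, -1, 1, -5, -3⟩ : WeierstrassCurve ℤ).map (Int.castRingHom ℚ)).conductorNorm ℤ) := neZero_conductorNorm_of_isElliptic _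
  haveI i5 := Fact.mk (by norm_num : Nat.Prime 5)
  have hsp := spade_5
  have hKN : ∀ v : HeightOneSpectrum (𝓞 ℚ), ((⟨0, -1, 1, -5, -3⟩ : WeierstrassCurve ℤ).map (Int.castRingHom ℚ)).HasMultiplicativeReductionAt v →
      ¬ 5 ∣ ((⟨0, -1, 1, -5, -3⟩ : WeierstrassCurve ℤ).map (Int.castRingHom ℚ)).ordMinimalDiscriminant v :=
    not_dvd_ordMinimalDiscriminant_of_intModel_table intModel (p := 5) (Δ₀ := 997) (by decide +kernel)
      (B := 8) (by decide +kernel) (by decide +kernel)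
  have hS2 : ¬ Squarefree (((⟨0, -1, 1, -5, -3⟩ : WeierstrassCurve ℤ).map (Int.castRingHom ℚ)).conductorNorm ℤ) →
      (∃ (ℓ : ℕ) (_ : Fact ℓ.Prime), ((⟨0, -1, 1, -5, -3⟩ : WeierstrassCurve ℤ).map (Int.castRingHom ℚ)).HasMultiplicativeReductionAtPrime ℓ ∧
          ¬ 5 ∣ padicValInt ℓ ((⟨0, -1, 1, -5, -3⟩ : WeierstrassCurve ℤ).map (Int.castRingHom ℚ)).minimalDiscriminantInt) ∧
        ∃ (ℓ₁ ℓ₂ : ℕ) (_ : Fact ℓ₁.Prime) (_ : Fact ℓ₂.Prime), ℓ₁ ≠ ℓ₂ ∧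
          ((⟨0, -1, 1, -5, -3⟩ : WeierstrassCurve ℤ).map (Int.castRingHom ℚ)).HasMultiplicativeReductionAtPrime ℓ₁ ∧ ((⟨0, -1, 1, -5, -3⟩ : WeierstrassCurve ℤ).map (Int.castRingHom ℚ)).HasMultiplicativeReductionAtPrime ℓ₂ :=
    fun hns ↦ absurd (((⟨0, -1, 1, -5, -3⟩ : WeierstrassCurve ℤ).map (Int.castRingHom ℚ)).isSemistable_iff_squarefree_conductorNorm.mp hsp.2) hns
  have hH := satisfiesHeegnerHypothesis_conductorNorm_of_intModel intModel K hK.1 hD heegner_neg52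
  have hD3 : NumberField.discr K ≠ -3 := by rw [hD]; norm_num
  have hD4 : NumberField.discr K ≠ -4 := by rw [hD]; norm_num
  have hpD : ¬ (((5 : ℕ) : ℤ) ∣ NumberField.discr K) := by rw [hD]; norm_num
  have hr : 2 ≤ ((⟨0, -1, 1, -5, -3⟩ : WeierstrassCurve ℤ).map (Int.castRingHom ℚ)).mordellWeilRank := KernelCertsR01.C997b1.two_le_rank
  have hT' : Nat.card ((((⟨0, -1, 1, -5, -3⟩ : WeierstrassCurve ℤ).map (Int.castRingHom ℚ)).quadraticTwist (NumberField.discr K : ℚ)).selmerGroup (5 : ℕ)) ≤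
      5 ^ ((⟨0, -1, 1, -5, -3⟩ : WeierstrassCurve ℤ).map (Int.castRingHom ℚ)).mordellWeilRank :=
    hT.trans (Nat.le_self_pow (by omega) 5)
  exact cruxBody_of_sha_of_twistSelmer_of_lemma84 h84 _ hr 5 (by norm_num) goodOrdinary_5.1 goodOrdinary_5.2
    hasSurjectiveModNGaloisRep_pow_5 hKN hsp.1 hS2 K hK hD3 hD4 hpD hH (sha_inf_torsionBy_five_eq_bot hSW) hT'

end C997b1

/-! ## `997c1` (`N = 997`, no 2-descent certificate; `2 ≤ rank` by `KernelCerts003.C997c1.two_le_rank`) -/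

namespace C997c1

/-- **`Ш(997c1/ℚ)[5] = 0` BY NAME** (Stein–Wuthrich 2013 Thm. 1.1: non-CM `not_hasCM`, `2 ≤ rank` `KernelCerts003.C997c1.two_le_rank` — two
kernel points, NO 2-descent certificate needed —, `N = 997 ≤ 30000` `conductorNorm_eq`, `5` good ordinary `goodOrdinary_5`,
`ρ̄_{E,5}` onto `hasSurjectiveModNGaloisRep_pow_5 1`). CONDITIONAL on that named fact; per curve; BSD is not proved by it.
[cite: SteinWuthrich2013, Thm. 1.1 (p. 1758)] [cite: CremonaAlgorithms1997, Table 1 (997c1)] -/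
theorem sha_inf_torsionBy_five_eq_bot (hSW : SteinWuthrich2013_sha_inf_torsionBy_eq_bot_of_two_le_rank) :
    haveI := isElliptic_c997c1;
    haveI := isGloballyMinimal_c997c1;
    haveI := Fact.mk (by norm_num : Nat.Prime 5);
    (((⟨0, -1, 1, -24, 54⟩ : WeierstrassCurve ℤ).map (Int.castRingHom ℚ)).sha ⊓ AddSubgroup.torsionBy ((⟨0, -1, 1, -24, 54⟩ : WeierstrassCurve ℤ).map (Int.castRingHom ℚ)).galH1 ((5 : ℕ) : ℤ) : AddSubgroup _) = ⊥ := by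
  haveI := isElliptic_c997c1
  haveI := isGloballyMinimal_c997c1
  haveI := Fact.mk (by norm_num : Nat.Prime 5)
  have hsur : ((⟨0, -1, 1, -24, 54⟩ : WeierstrassCurve ℤ).map (Int.castRingHom ℚ)).HasSurjectiveModNGaloisRep (5 ^ 1 : ℕ) := hasSurjectiveModNGaloisRep_pow_5 1
  rw [pow_one] at hsur
  exact hSW _ not_hasCM KernelCerts003.C997c1.two_le_rank (by rw [conductorNorm_eq]; norm_num) 5 (by norm_num) (by norm_num)
    goodOrdinary_5.1 goodOrdinary_5.2 hsur

/-- **DEPTH-TABLE ROW `997c1`, `(p, d_K) = (5, -23)`, v13 modulo the rank of `E` — «ONE BIT ⟺ `rank E = 2` ∧ ONE TWIST».**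
For `E = 997c1` and ANY imaginary quadratic `K` with `d_K = -23`: bit `↔` «`rank_ℤ E(ℚ) = 2` ∧ `rank_ℤ E^{(-23)}(ℚ) = 1` ∧
`Ш(E^{(-23)}/ℚ)[5] = 0`» — from the v12 row `exactRowZhang_5_neg23_twoShaModRank` with its `E`-side conjunct `Ш(E)[5] = 0`
discharged by SW Thm. 1.1; the `rank E = 2` conjunct stays (no 2-descent certificate; it drops by `and_iff_right` when the
observatory lands one). CONDITIONAL on (γ), W. Zhang L8.4 (1) / 9.1 and SW Thm. 1.1 by name; per curve; BSD is not proved by it.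
[cite: SteinWuthrich2013, Thm. 1.1 (p. 1758)] [cite: WZhang2014, Lemma 8.4 (1) (p. 236), Thm. 9.1 (p. 240)] [cite: GrossLMS1991, Prop. 3.7 (2)] -/
theorem exactRowZhang_5_neg23_oneTwistModRank
    (hSW : SteinWuthrich2013_sha_inf_torsionBy_eq_bot_of_two_le_rank)
    (h372 : GrossLMS1991.prop37_2_frobeniusCongruence)
    (h84 : Literature.NumberTheory.EllipticCurves.WZhang2014_lemma84_exists_minimal_kolyvaginClass_one_selmerCard)
    (K : Type) [Field K] [NumberField K] (hK : IsImaginaryQuadratic K)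
    (hD : NumberField.discr K = -23) :
    haveI := isElliptic_c997c1;
    haveI := isGloballyMinimal_c997c1;
    haveI : NeZero (((⟨0, -1, 1, -24, 54⟩ : WeierstrassCurve ℤ).map (Int.castRingHom ℚ)).conductorNorm ℤ) := neZero_conductorNorm_of_isElliptic _;
    haveI := Fact.mk (by norm_num : Nat.Prime 5);
    (∃ (Dt : ModularParametrizationData ((⟨0, -1, 1, -24, 54⟩ : WeierstrassCurve ℤ).map (Int.castRingHom ℚ)) (((⟨0, -1, 1, -24, 54⟩ : WeierstrassCurve ℤ).map (Int.castRingHom ℚ)).conductorNorm ℤ)) (β : ℤ)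
      (ι : K →+* ℂ) (ℓ : ℕ) (d : KolyvaginHeegnerData Dt β ι ℓ),
      ℓ.Prime ∧ Zhang2014.IsKolyvaginPrime (((⟨0, -1, 1, -24, 54⟩ : WeierstrassCurve ℤ).map (Int.castRingHom ℚ)).conductorNorm ℤ) ((⟨0, -1, 1, -24, 54⟩ : WeierstrassCurve ℤ).map (Int.castRingHom ℚ)) K 5 ℓ ∧
        d.kolyvaginClass (p := 5) (by norm_num) 1 ≠ 0) ↔
    (((⟨0, -1, 1, -24, 54⟩ : WeierstrassCurve ℤ).map (Int.castRingHom ℚ)).mordellWeilRank = 2 ∧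
      (((⟨0, -1, 1, -24, 54⟩ : WeierstrassCurve ℤ).map (Int.castRingHom ℚ)).quadraticTwist (NumberField.discr K : ℚ)).mordellWeilRank = 1 ∧
      ((((⟨0, -1, 1, -24, 54⟩ : WeierstrassCurve ℤ).map (Int.castRingHom ℚ)).quadraticTwist (NumberField.discr K : ℚ)).sha ⊓
          AddSubgroup.torsionBy (((⟨0, -1, 1, -24, 54⟩ : WeierstrassCurve ℤ).map (Int.castRingHom ℚ)).quadraticTwist (NumberField.discr K : ℚ)).galH1 ((5 : ℕ) : ℤ) :
          AddSubgroup (((⟨0, -1, 1, -24, 54⟩ : WeierstrassCurve ℤ).map (Int.castRingHom ℚ)).quadraticTwist (NumberField.discr K : ℚ)).galH1) = ⊥) := by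
  haveI := isElliptic_c997c1
  haveI := isGloballyMinimal_c997c1
  haveI : NeZero (((⟨0, -1, 1, -24, 54⟩ : WeierstrassCurve ℤ).map (Int.castRingHom ℚ)).conductorNorm ℤ) := neZero_conductorNorm_of_isElliptic _
  haveI := Fact.mk (by norm_num : Nat.Prime 5)
  exact (exactRowZhang_5_neg23_twoShaModRank h372 h84 K hK hD).trans
    (and_congr_right fun _ ↦ and_iff_right (sha_inf_torsionBy_five_eq_bot hSW))

/-- **THE CRUX `KolyvaginDepthSupplyKN` AT `997c1`, MODULO ONE RANK-ONE DATUM — NO 2-DESCENT CERTIFICATE NEEDED.**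
Granted SW Thm. 1.1 and W. Zhang L8.4 (1) / 9.1 by name and, for ONE imaginary quadratic `K` with `d_K = -67` (field of
record), the bound `#Sel_5(E^{(d_K)}/ℚ) ≤ 5` on the rank-one Heegner twist, the CLAUSE of the crux holds at `W = 997c1`
verbatim (`cruxBody_of_sha_of_twistSelmer_of_lemma84` at the kernel certificates: two points `KernelCerts003.C997c1.two_le_rank`, `5` good
ordinary, `ρ_{E,5^∞}` onto, Kodaira–Néron and ♠ from `Δ(E₀) = 997` (`spade_5`), Heegner `heegner_neg67`; `5 ≤ 5 ^ rank`).
CONDITIONAL on the two named facts and the one twist datum; per curve; BSD is not proved by it.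
[cite: SteinWuthrich2013, Thm. 1.1 (p. 1758)] [cite: WZhang2014, Lemma 8.4 (1) (p. 236), Thm. 9.1 (p. 240)] [cite: CremonaAlgorithms1997, Table 1 (997c1)] -/
theorem cruxBody_of_twistSelmer
    (hSW : SteinWuthrich2013_sha_inf_torsionBy_eq_bot_of_two_le_rank)
    (h84 : Literature.NumberTheory.EllipticCurves.WZhang2014_lemma84_exists_minimal_kolyvaginClass_one_selmerCard)
    (K : Type) [Field K] [NumberField K] (hK : IsImaginaryQuadratic K)
    (hD : NumberField.discr K = -67)
    (hT : haveI := isElliptic_c997c1; haveI := isGloballyMinimal_c997c1;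
      Nat.card ((((⟨0, -1, 1, -24, 54⟩ : WeierstrassCurve ℤ).map (Int.castRingHom ℚ)).quadraticTwist (NumberField.discr K : ℚ)).selmerGroup (5 : ℕ)) ≤ 5) :
    haveI := isElliptic_c997c1;
    haveI := isGloballyMinimal_c997c1;
    ∃ (p : ℕ) (hp : Fact p.Prime), 5 ≤ p ∧ ((⟨0, -1, 1, -24, 54⟩ : WeierstrassCurve ℤ).map (Int.castRingHom ℚ)).HasGoodReductionAtPrime p ∧
      ¬ (p : ℤ) ∣ ((⟨0, -1, 1, -24, 54⟩ : WeierstrassCurve ℤ).map (Int.castRingHom ℚ)).frobeniusTrace p ∧ (∀ n : ℕ, ((⟨0, -1, 1, -24, 54⟩ : WeierstrassCurve ℤ).map (Int.castRingHom ℚ)).HasSurjectiveModNGaloisRep (p ^ n : ℕ)) ∧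
      (∀ v : HeightOneSpectrum (𝓞 ℚ), ((⟨0, -1, 1, -24, 54⟩ : WeierstrassCurve ℤ).map (Int.castRingHom ℚ)).HasMultiplicativeReductionAt v →
        ¬ p ∣ ((⟨0, -1, 1, -24, 54⟩ : WeierstrassCurve ℤ).map (Int.castRingHom ℚ)).ordMinimalDiscriminant v) ∧
      ∃ (K : Type) (_ : Field K) (_ : NumberField K), IsImaginaryQuadratic K ∧
        NumberField.discr K ≠ -3 ∧ NumberField.discr K ≠ -4 ∧
        ∃ (_ : NeZero (((⟨0, -1, 1, -24, 54⟩ : WeierstrassCurve ℤ).map (Int.castRingHom ℚ)).conductorNorm ℤ)), SatisfiesHeegnerHypothesis (((⟨0, -1, 1, -24, 54⟩ : WeierstrassCurve ℤ).map (Int.castRingHom ℚ)).conductorNorm ℤ) K ∧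
        ∃ (Dt : ModularParametrizationData ((⟨0, -1, 1, -24, 54⟩ : WeierstrassCurve ℤ).map (Int.castRingHom ℚ)) (((⟨0, -1, 1, -24, 54⟩ : WeierstrassCurve ℤ).map (Int.castRingHom ℚ)).conductorNorm ℤ)) (β : ℤ) (ι : K →+* ℂ) (n₁ : ℕ)
          (d : KolyvaginHeegnerData Dt β ι n₁), Squarefree n₁ ∧
          (∀ q ∈ n₁.primeFactors, Zhang2014.IsKolyvaginPrime (((⟨0, -1, 1, -24, 54⟩ : WeierstrassCurve ℤ).map (Int.castRingHom ℚ)).conductorNorm ℤ) ((⟨0, -1, 1, -24, 54⟩ : WeierstrassCurve ℤ).map (Int.castRingHom ℚ)) K p q) ∧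
          d.kolyvaginClass hp.out 1 ≠ 0 ∧
          (n₁.primeFactors.card + 1 ≤ ((⟨0, -1, 1, -24, 54⟩ : WeierstrassCurve ℤ).map (Int.castRingHom ℚ)).mordellWeilRank ∨
            (n₁.primeFactors.card ≤ ((⟨0, -1, 1, -24, 54⟩ : WeierstrassCurve ℤ).map (Int.castRingHom ℚ)).mordellWeilRank ∧
              n₁.primeFactors.card + 1 ≤ (((⟨0, -1, 1, -24, 54⟩ : WeierstrassCurve ℤ).map (Int.castRingHom ℚ)).quadraticTwist (NumberField.discr K : ℚ)).mordellWeilRank)) := by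
  haveI := isElliptic_c997c1
  haveI := isGloballyMinimal_c997c1
  haveI iNZ : NeZero (((⟨0, -1, 1, -24, 54⟩ : WeierstrassCurve ℤ).map (Int.castRingHom ℚ)).conductorNorm ℤ) := neZero_conductorNorm_of_isElliptic _
  haveI i5 := Fact.mk (by norm_num : Nat.Prime 5)
  have hsp := spade_5
  have hKN : ∀ v : HeightOneSpectrum (𝓞 ℚ), ((⟨0, -1, 1, -24, 54⟩ : WeierstrassCurve ℤ).map (Int.castRingHom ℚ)).HasMultiplicativeReductionAt v →
      ¬ 5 ∣ ((⟨0, -1, 1, -24, 54⟩ : WeierstrassCurve ℤ).map (Int.castRingHom ℚ)).ordMinimalDiscriminant v :=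
    not_dvd_ordMinimalDiscriminant_of_intModel_table intModel (p := 5) (Δ₀ := 997) (by decide +kernel)
      (B := 8) (by decide +kernel) (by decide +kernel)
  have hS2 : ¬ Squarefree (((⟨0, -1, 1, -24, 54⟩ : WeierstrassCurve ℤ).map (Int.castRingHom ℚ)).conductorNorm ℤ) →
      (∃ (ℓ : ℕ) (_ : Fact ℓ.Prime), ((⟨0, -1, 1, -24, 54⟩ : WeierstrassCurve ℤ).map (Int.castRingHom ℚ)).HasMultiplicativeReductionAtPrime ℓ ∧
          ¬ 5 ∣ padicValInt ℓ ((⟨0, -1, 1, -24, 54⟩ : WeierstrassCurve ℤ).map (Int.castRingHom ℚ)).minimalDiscriminantInt) ∧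
        ∃ (ℓ₁ ℓ₂ : ℕ) (_ : Fact ℓ₁.Prime) (_ : Fact ℓ₂.Prime), ℓ₁ ≠ ℓ₂ ∧
          ((⟨0, -1, 1, -24, 54⟩ : WeierstrassCurve ℤ).map (Int.castRingHom ℚ)).HasMultiplicativeReductionAtPrime ℓ₁ ∧ ((⟨0, -1, 1, -24, 54⟩ : WeierstrassCurve ℤ).map (Int.castRingHom ℚ)).HasMultiplicativeReductionAtPrime ℓ₂ :=
    fun hns ↦ absurd (((⟨0, -1, 1, -24, 54⟩ : WeierstrassCurve ℤ).map (Int.castRingHom ℚ)).isSemistable_iff_squarefree_conductorNorm.mp hsp.2) hns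
  have hH := satisfiesHeegnerHypothesis_conductorNorm_of_intModel intModel K hK.1 hD heegner_neg67
  have hD3 : NumberField.discr K ≠ -3 := by rw [hD]; norm_num
  have hD4 : NumberField.discr K ≠ -4 := by rw [hD]; norm_num
  have hpD : ¬ (((5 : ℕ) : ℤ) ∣ NumberField.discr K) := by rw [hD]; norm_num
  have hr : 2 ≤ ((⟨0, -1, 1, -24, 54⟩ : WeierstrassCurve ℤ).map (Int.castRingHom ℚ)).mordellWeilRank := KernelCerts003.C997c1.two_le_rank
  have hT' : Nat.card ((((⟨0, -1, 1, -24, 54⟩ : WeierstrassCurve ℤ).map (Int.castRingHom ℚ)).quadraticTwist (NumberField.discr K : ℚ)).selmerGroup (5 : ℕ)) ≤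
      5 ^ ((⟨0, -1, 1, -24, 54⟩ : WeierstrassCurve ℤ).map (Int.castRingHom ℚ)).mordellWeilRank :=
    hT.trans (Nat.le_self_pow (by omega) 5)
  exact cruxBody_of_sha_of_twistSelmer_of_lemma84 h84 _ hr 5 (by norm_num) goodOrdinary_5.1 goodOrdinary_5.2
    hasSurjectiveModNGaloisRep_pow_5 hKN hsp.1 hS2 K hK hD3 hD4 hpD hH (sha_inf_torsionBy_five_eq_bot hSW) hT'

end C997c1

end Summit.BirchSwinnertonDyer.BirchSwinnertonDyer.Theorems.KolyvaginDepthDoor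

end
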